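import Summits.AtomisticToContinuum.Crystallization.Theorems.SquareWellLayerCakeStackingFaultSparsityLocalFramesCommonNormal

/-!
# Radius bootstrap of crux 14294, stub W2: the level gap in the common-normal case

Crux `StackingFaultSparsity` (stmt-AtomisticToContinuum-14296), line `Sketch`, reshape 14 (lead c8): registered stub
`stub_gapBound`.  Under the hypotheses of the landed S3 `stub_barlowOfCommonNormal` (exact local frames with common
lengths `(a, b)` and common normal `±n` on a nonempty `X`) the stacking gap `√(b² − a²/3)` is at least `19/25`:
rerun S3's proof (`cn_frame_facts`, `gl_exists_rotation_height`, `cn_img_sep/sharp/finset`, `stub_hexClosure`,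
`stub_levelLattice`, `cn_img_gap`) and apply `stub_levelRegistry` at `0`: the level at height `√(b² − a²/3)` is a
nonempty lattice coset, and two distinct heights are `≥ 19/25` apart.  All `[folklore]`.
-/

noncomputable section

namespace Summit.AtomisticToContinuum.Crystallization.Theorems.SquareWellLayerCake.StackingFaultSparsity.Bootstrap.GapBound

open Literature.MathematicalPhysics.StatisticalMechanics
open Summit.AtomisticToContinuum.Crystallization.Theorems.PeriodicWindowsSketch
open Summit.AtomisticToContinuum.Crystallization.Theorems.SquareWellLayerCake.StackingFaultSparsity.LocalFrames.CommonNormal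

/-- **Stub `stub_gapBound` of line `Sketch` (reshape 14), by name and signature.** [folklore] -/
theorem stub_gapBound :
    ∀ (X : Set (EuclideanSpace ℝ (Fin 3))) (a b : ℝ) (n : EuclideanSpace ℝ (Fin 3)), X.Nonempty → (∀ p ∈ X, (∃ c : ℤ → ℝ, (19 / 20 ≤ a ∧ a ≤ 1 ∧ 19 / 20 ≤ b ∧ b ≤ 1 ∧ ‖n‖ = 1 ∧ c 0 = 0 ∧ (∀ k : ℤ, c k + 19 / 25 ≤ c (k + 1)) ∧ (∀ q ∈ X, ∀ r ∈ X, q ≠ r → 19 / 20 ≤ dist q r) ∧ (∀ q ∈ X, dist q p < 2 → ∃ k : ℤ, inner ℝ (q - p) n = c k) ∧ (∃ H U D : Finset (EuclideanSpace ℝ (Fin 3)), H.card = 6 ∧ U.card = 3 ∧ D.card = 3 ∧ (∀ q ∈ H, q ∈ X ∧ inner ℝ (q - p) n = 0 ∧ dist p q = a) ∧ (∀ q ∈ U, q ∈ X ∧ inner ℝ (q - p) n = c 1 ∧ dist p q = b) ∧ (∀ q ∈ D, q ∈ X ∧ inner ℝ (q - p) n = c (-1) ∧ dist p q = b) ∧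 (∀ q ∈ X, q ≠ p → dist q p ≤ 1 → q ∈ H ∨ q ∈ U ∨ q ∈ D)) ∧ (∀ q ∈ X, q ≠ p → dist q p ≤ 1 → (∃ H' : Finset (EuclideanSpace ℝ (Fin 3)), H'.card = 6 ∧ ∀ r ∈ H', r ∈ X ∧ r ≠ q ∧ inner ℝ (r - p) n = inner ℝ (q - p) n ∧ dist q r = a) ∧ (∃ U' : Finset (EuclideanSpace ℝ (Fin 3)), U'.card = 3 ∧ ∀ r ∈ U', r ∈ X ∧ (∃ k : ℤ, inner ℝ (q - p) n = c k ∧ inner ℝ (r - p) n = c (k + 1)) ∧ dist q r = b) ∧ (∃ D' : Finset (EuclideanSpace ℝ (Fin 3)), D'.card = 3 ∧ ∀ r ∈ D', r ∈ X ∧ (∃ k : ℤ, inner ℝ (q - p) n = c k ∧ inner ℝ (r - p) n = c (k - 1)) ∧ dist q r = b) ∧ (∀ r ∈ X, r ≠ q → dist q r < 1 → (inner ℝ (r - p) n = inner ℝ (q - p) n → dist q r = a) ∧ (inner ℝ (r - p) n ≠ inner ℝ (q - p) n → dist q r = b))))) ∨ (∃ c : ℤ → ℝ, (19 / 20 ≤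 a ∧ a ≤ 1 ∧ 19 / 20 ≤ b ∧ b ≤ 1 ∧ ‖(-n)‖ = 1 ∧ c 0 = 0 ∧ (∀ k : ℤ, c k + 19 / 25 ≤ c (k + 1)) ∧ (∀ q ∈ X, ∀ r ∈ X, q ≠ r → 19 / 20 ≤ dist q r) ∧ (∀ q ∈ X, dist q p < 2 → ∃ k : ℤ, inner ℝ (q - p) (-n) = c k) ∧ (∃ H U D : Finset (EuclideanSpace ℝ (Fin 3)), H.card = 6 ∧ U.card = 3 ∧ D.card = 3 ∧ (∀ q ∈ H, q ∈ X ∧ inner ℝ (q - p) (-n) = 0 ∧ dist p q = a) ∧ (∀ q ∈ U, q ∈ X ∧ inner ℝ (q - p) (-n) = c 1 ∧ dist p q = b) ∧ (∀ q ∈ D, q ∈ X ∧ inner ℝ (q - p) (-n) = c (-1) ∧ dist p q = b) ∧ (∀ q ∈ X, q ≠ p → dist q p ≤ 1 → q ∈ H ∨ q ∈ U ∨ q ∈ D)) ∧ (∀ q ∈ X, q ≠ p → dist q p ≤ 1 → (∃ H' : Finset (EuclideanSpace ℝ (Fin 3)), H'.card = 6 ∧ ∀ r ∈ H', r ∈ X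 ∧ r ≠ q ∧ inner ℝ (r - p) (-n) = inner ℝ (q - p) (-n) ∧ dist q r = a) ∧ (∃ U' : Finset (EuclideanSpace ℝ (Fin 3)), U'.card = 3 ∧ ∀ r ∈ U', r ∈ X ∧ (∃ k : ℤ, inner ℝ (q - p) (-n) = c k ∧ inner ℝ (r - p) (-n) = c (k + 1)) ∧ dist q r = b) ∧ (∃ D' : Finset (EuclideanSpace ℝ (Fin 3)), D'.card = 3 ∧ ∀ r ∈ D', r ∈ X ∧ (∃ k : ℤ, inner ℝ (q - p) (-n) = c k ∧ inner ℝ (r - p) (-n) = c (k - 1)) ∧ dist q r = b) ∧ (∀ r ∈ X, r ≠ q → dist q r < 1 → (inner ℝ (r - p) (-n) = inner ℝ (q - p) (-n) → dist q r = a) ∧ (inner ℝ (r - p) (-n) ≠ inner ℝ (q - p) (-n) → dist q r = b)))))) → 19 / 25 ≤ √(b ^ 2 - a ^ 2 / 3) := by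
  intro X a b n hne hfr
  -- the frame at every point, read with normal `n` (first half of S3 `stub_barlowOfCommonNormal`)
  have hP : ∀ p ∈ X, (19 / 20 ≤ a ∧ a ≤ 1 ∧ 19 / 20 ≤ b ∧ b ≤ 1 ∧ ‖n‖ = 1 ∧
        ∀ q ∈ X, ∀ r ∈ X, q ≠ r → 19 / 20 ≤ dist q r) ∧
      (∀ q ∈ X, q ≠ p → dist q p < 1 → inner ℝ (q - p) n = 0 → dist p q = a) ∧
      (∃ F : Finset (EuclideanSpace ℝ (Fin 3)), F.card = 6 ∧
        ∀ q ∈ F, q ∈ X ∧ inner ℝ (q - p) n = 0 ∧ dist p q = a) ∧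
      (∃ g : ℝ, 0 < g ∧ ∃ F : Finset (EuclideanSpace ℝ (Fin 3)), F.card = 3 ∧
        ∀ q ∈ F, q ∈ X ∧ inner ℝ (q - p) n = g ∧ dist p q = b) ∧
      (∃ g : ℝ, 0 < g ∧ ∃ F : Finset (EuclideanSpace ℝ (Fin 3)), F.card = 3 ∧
        ∀ q ∈ F, q ∈ X ∧ inner ℝ (q - p) n = -g ∧ dist p q = b) ∧
      (∀ q ∈ X, dist q p < 2 → inner ℝ (q - p) n = 0 ∨ 19 / 25 ≤ |inner ℝ (q - p) n|) := by
    intro p hp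
    rcases hfr p hp with h | h
    · exact cn_frame_facts h
    · obtain ⟨⟨ha1, ha2, hb1, hb2, hm, hsep⟩, h1, h2, h3, h4, h5⟩ := cn_frame_facts h
      exact ⟨⟨ha1, ha2, hb1, hb2, by rwa [norm_neg] at hm, hsep⟩, cn_facts_of_neg h1 h2 h3 h4 h5⟩
  obtain ⟨p₀, hp₀⟩ := hne
  obtain ⟨⟨ha1, ha2, hb1, hb2, hn, hsep⟩, -⟩ := hP p₀ hp₀
  obtain ⟨B, hB⟩ := gl_exists_rotation_height n hn
  -- the hypotheses of E0b1–3 for `X' = {B (x − p₀) | x ∈ X}`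
  have h0 : (0 : EuclideanSpace ℝ (Fin 3)) ∈ (fun x => B (x - p₀)) '' X := ⟨p₀, hp₀, by simp⟩
  have hsep' := cn_img_sep B p₀ hsep
  have hsharp' := cn_img_sharp B hB p₀ fun p hp => (hP p hp).2.1
  have hsix' : ∀ p ∈ (fun x => B (x - p₀)) '' X,
      ∃ F : Finset (EuclideanSpace ℝ (Fin 3)), F.card = 6 ∧
        ∀ q ∈ F, q ∈ (fun x => B (x - p₀)) '' X ∧ q 2 = p 2 ∧ dist p q = a := by
    rintro _ ⟨x, hx, rfl⟩
    obtain ⟨F, hF, hFm⟩ := cn_img_finset B hB p₀ x (hP x hx).2.2.1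
    exact ⟨F, hF, fun q hq => let ⟨y1, y2, y3⟩ := hFm q hq; ⟨y1, by rw [y2, add_zero], y3⟩⟩
  have hup' : ∀ p ∈ (fun x => B (x - p₀)) '' X, ∃ g : ℝ, 0 < g ∧
      ∃ F : Finset (EuclideanSpace ℝ (Fin 3)), F.card = 3 ∧
        ∀ q ∈ F, q ∈ (fun x => B (x - p₀)) '' X ∧ q 2 = p 2 + g ∧ dist p q = b := by
    rintro _ ⟨x, hx, rfl⟩
    obtain ⟨g, hg, hF⟩ := (hP x hx).2.2.2.1
    exact ⟨g, hg, cn_img_finset B hB p₀ x hF⟩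
  have hdn' : ∀ p ∈ (fun x => B (x - p₀)) '' X, ∃ g : ℝ, 0 < g ∧
      ∃ F : Finset (EuclideanSpace ℝ (Fin 3)), F.card = 3 ∧
        ∀ q ∈ F, q ∈ (fun x => B (x - p₀)) '' X ∧ q 2 = p 2 - g ∧ dist p q = b := by
    rintro _ ⟨x, hx, rfl⟩
    obtain ⟨g, hg, hF⟩ := (hP x hx).2.2.2.2.1
    obtain ⟨F, hF, hFm⟩ := cn_img_finset B hB p₀ x hF
    exact ⟨g, hg, F, hF, fun q hq => let ⟨y1, y2, y3⟩ := hFm q hq; ⟨y1, by rw [y2]; ring, y3⟩⟩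
  have hhex := stub_hexClosure _ a ha1 ha2 hsharp' hsix'
  have hlat := stub_levelLattice _ a ha1 ha2 hsep' hsix' hhex
  have hgap := cn_img_gap ha1 ha2 B hB p₀ (fun p hp => (hP p hp).2.2.2.2.2) hlat
  -- the level of `X'` at height `√(b² − a²/3)` above `0` is a (nonempty) lattice coset
  obtain ⟨u, v, hu2, hv2, hu, hv, huv, hlev0⟩ := hlat 0 h0
  obtain ⟨hh1, -⟩ := sqrt_gap_bounds ha1 ha2 hb1 hb2
  obtain ⟨σ, τ, -, -, hupper, -, -⟩ := stub_levelRegistry _ a b ha1 ha2 hb1 hb2 hsep' hgap hlat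
    hup' hdn' 0 h0 u v hu2 hv2 hu hv huv hlev0
  have hq : (0 : EuclideanSpace ℝ (Fin 3)) + Real.sqrt (b ^ 2 - a ^ 2 / 3) •
      EuclideanSpace.single (2 : Fin 3) (1 : ℝ) + σ • ((1 / 3 : ℝ) • (u + v)) +
      ((0 : ℤ) : ℝ) • u + ((0 : ℤ) : ℝ) • v ∈
      {q ∈ (fun x => B (x - p₀)) '' X |
        q 2 = (0 : EuclideanSpace ℝ (Fin 3)) 2 + Real.sqrt (b ^ 2 - a ^ 2 / 3)} := by
    rw [hupper]
    exact ⟨0, 0, rfl⟩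
  obtain ⟨hqX, hq2⟩ := hq
  -- the global level-gap dichotomy between `0` and that point
  rcases hgap 0 h0 _ hqX with h | h
  · rw [h] at hq2
    linarith
  · rw [hq2, add_sub_cancel_left] at h
    rwa [abs_of_nonneg (Real.sqrt_nonneg _)] at h

end Summit.AtomisticToContinuum.Crystallization.Theorems.SquareWellLayerCake.StackingFaultSparsity.Bootstrap.GapBound

end
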